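import Summits.RiemannHypothesis.RiemannHypothesis.Theorems.WeilFormatCWindowSummable
import Summits.RiemannHypothesis.RiemannHypothesis.Theorems.WeilFormatCWindowGram
import HarnessLib

/-!
# Format C, design C∞ (L2 backbone): polarization of the window sesquilinear form and its continuity along Fourier truncation

Route context: Fourier–Galerkin / Schur-complement certificates of Weil positivity on a window ("format C";
cell memo `run/shared/lean/pub/rh-explicit/rh-explicit-weil-10/FORMATC-DESIGN.md` §9.12.11; supporting
stmt-RiemannHypothesis-0098; seat rh-explicit-weil-10).  The deflated certificate's ENTRIES are values of the window sesquilinear form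
`weilWindowSesq a` between Fourier modes and deflation profiles; `WeilFormatCDeflatedFarLimit` needs them as LIMITS of the finite
Gram sums, i.e. `weilWindowSesq a (proj a N u) (proj a N v) → weilWindowSesq a u v`.  This file derives that from the quadratic
statement `WeilFormatCWindowSummable.tendsto_weilWindowForm_proj_of_summable` by polarization.

* `weilWindowSesq_add_right`, `weilWindowSesq_smul_right`, `weilWindowSesq_add_smul_self` — sesquilinear bookkeeping;
* `weilWindowSesq_polarization` — `S(u,v) = ¼[(Q(u+v) − Q(u−v)) + i(Q(u+iv) − Q(u−iv))]`;
* `tendsto_weilWindowSesq_of_forms` — convergence of `S(u_N, v_N)` from the four quadratic limits;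
* `fourierCoeff_add_smul_of_continuousOn`, `proj_add_smul_of_continuousOn` — linearity of the truncation on continuous windows;
* `tendsto_weilWindowSesq_proj_of_summable` — the sesquilinear dictionary for the summable class.

Pure bookkeeping; standard axioms; no RH claim.
-/

set_option autoImplicit false
-- `Summit.RiemannHypothesis.RiemannHypothesis.…` is the layout-mandated namespace (summit = problem name).
set_option linter.dupNamespace false

noncomputable section

open Complex Filter Set MeasureTheory
open scoped Real Topology ComplexConjugate

namespace Summit.RiemannHypothesis.RiemannHypothesis.Theorems.WeilFormatC

open Literature.NumberTheory.LFunctions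
open Literature.NumberTheory.LFunctions.Yoshida1992 (modes chi proj)

variable {a : ℝ} {u v : ℝ → ℂ}

/-! ## Sesquilinear bookkeeping -/

/-- Additivity in the second argument (from `add_left` and conjugate symmetry). -/
theorem weilWindowSesq_add_right (ha : 0 ≤ a) (hu : IsWindowFunction a u) {v₁ v₂ : ℝ → ℂ}
    (hv₁ : IsWindowFunction a v₁) (hv₂ : IsWindowFunction a v₂) :
    weilWindowSesq a u (v₁ + v₂) = weilWindowSesq a u v₁ + weilWindowSesq a u v₂ := by
  rw [weilWindowSesq_conj_symm a (v₁ + v₂) u, weilWindowSesq_add_left ha hv₁ hv₂ hu a, map_add,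
    ← weilWindowSesq_conj_symm a v₁ u, ← weilWindowSesq_conj_symm a v₂ u]

/-- Conjugate homogeneity in the second argument. -/
theorem weilWindowSesq_smul_right (a : ℝ) (c : ℂ) (u v : ℝ → ℂ) :
    weilWindowSesq a u (c • v) = conj c * weilWindowSesq a u v := by
  rw [weilWindowSesq_conj_symm a (c • v) u, weilWindowSesq_smul_left, map_mul, ← weilWindowSesq_conj_symm a v u]

/-- Expansion of the quadratic form of `u + c•v`:
`Q(u + cv) = S(u,u) + c̄·S(u,v) + c·S(v,u) + c·c̄·S(v,v)` (as complex numbers). -/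
theorem weilWindowSesq_add_smul_self (ha : 0 ≤ a) (hu : IsWindowFunction a u) (hv : IsWindowFunction a v) (c : ℂ) :
    (weilWindowForm a (u + c • v) : ℂ)
      = weilWindowSesq a u u + conj c * weilWindowSesq a u v + c * weilWindowSesq a v u
        + c * conj c * weilWindowSesq a v v := by
  have hcv : IsWindowFunction a (c • v) := hv.smul c
  rw [← weilWindowSesq_self, weilWindowSesq_add_left ha hu hcv (hu.add hcv) a,
    weilWindowSesq_add_right ha hu hu hcv, weilWindowSesq_add_right ha hcv hu hcv,
    weilWindowSesq_smul_right, weilWindowSesq_smul_left, weilWindowSesq_smul_left, weilWindowSesq_smul_right]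
  ring

/-- **Polarization**: `S(u,v) = ¼[(Q(u+v) − Q(u−v)) + i(Q(u+iv) − Q(u−iv))]`, written with `u + c•v`,
`c ∈ {1, −1, i, −i}`. -/
theorem weilWindowSesq_polarization (ha : 0 ≤ a) (hu : IsWindowFunction a u) (hv : IsWindowFunction a v) :
    weilWindowSesq a u v
      = (((weilWindowForm a (u + (1 : ℂ) • v) : ℂ) - weilWindowForm a (u + (-1 : ℂ) • v))
          + I * ((weilWindowForm a (u + I • v) : ℂ) - weilWindowForm a (u + (-I) • v))) / 4 := by
  rw [weilWindowSesq_add_smul_self ha hu hv, weilWindowSesq_add_smul_self ha hu hv,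
    weilWindowSesq_add_smul_self ha hu hv, weilWindowSesq_add_smul_self ha hu hv]
  simp only [map_one, map_neg, Complex.conj_I]
  have hI : I * I = -1 := Complex.I_mul_I
  linear_combination (weilWindowSesq a u v - weilWindowSesq a v u) / 2 * hI

/-- **Convergence of the sesquilinear form from the four quadratic limits.** -/
theorem tendsto_weilWindowSesq_of_forms (ha : 0 ≤ a) {uN vN : ℕ → ℝ → ℂ}
    (huN : ∀ N, IsWindowFunction a (uN N)) (hvN : ∀ N, IsWindowFunction a (vN N))
    (hu : IsWindowFunction a u) (hv : IsWindowFunction a v)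
    (hlim : ∀ c : ℂ, c = 1 ∨ c = -1 ∨ c = I ∨ c = -I →
      Tendsto (fun N ↦ weilWindowForm a (uN N + c • vN N)) atTop (𝓝 (weilWindowForm a (u + c • v)))) :
    Tendsto (fun N ↦ weilWindowSesq a (uN N) (vN N)) atTop (𝓝 (weilWindowSesq a u v)) := by
  have e : (fun N ↦ weilWindowSesq a (uN N) (vN N))
      = fun N ↦ (((weilWindowForm a (uN N + (1 : ℂ) • vN N) : ℂ) - weilWindowForm a (uN N + (-1 : ℂ) • vN N))
          + I * ((weilWindowForm a (uN N + I • vN N) : ℂ) - weilWindowForm a (uN N + (-I) • vN N))) / 4 :=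
    funext fun N ↦ weilWindowSesq_polarization ha (huN N) (hvN N)
  rw [e, weilWindowSesq_polarization ha hu hv]
  have hc : ∀ c : ℂ, c = 1 ∨ c = -1 ∨ c = I ∨ c = -I →
      Tendsto (fun N ↦ (weilWindowForm a (uN N + c • vN N) : ℂ)) atTop (𝓝 (weilWindowForm a (u + c • v) : ℂ)) :=
    fun c hc ↦ (Complex.continuous_ofReal.tendsto _).comp (hlim c hc)
  have h1 := hc 1 (Or.inl rfl)
  have h2 := hc (-1) (Or.inr (Or.inl rfl))
  have h3 := hc I (Or.inr (Or.inr (Or.inl rfl)))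
  have h4 := hc (-I) (Or.inr (Or.inr (Or.inr rfl)))
  exact ((h1.sub h2).add ((h3.sub h4).const_mul I)).div_const 4

/-! ## Linearity of the Fourier truncation on continuous windows -/

/-- `c_n(u + c•v) = c_n(u) + c·c_n(v)` for `u, v` continuous on the closed window (`a ≥ 0`). -/
theorem fourierCoeff_add_smul_of_continuousOn (ha : 0 ≤ a) (hu : ContinuousOn u (Icc (-a) a))
    (hv : ContinuousOn v (Icc (-a) a)) (c : ℂ) (n : ℤ) :
    Yoshida1992.fourierCoeff a n (u + c • v) = Yoshida1992.fourierCoeff a n u + c * Yoshida1992.fourierCoeff a n v := by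
  unfold Yoshida1992.fourierCoeff
  have he : Continuous fun x : ℝ ↦ cexp (-(π * I * n * x / a)) := by fun_prop
  have hIu : IntervalIntegrable (fun x ↦ u x * cexp (-(π * I * n * x / a))) volume (-a) a :=
    (hu.mul he.continuousOn).intervalIntegrable_of_Icc (by linarith)
  have hIv : IntervalIntegrable (fun x ↦ v x * cexp (-(π * I * n * x / a))) volume (-a) a :=
    (hv.mul he.continuousOn).intervalIntegrable_of_Icc (by linarith)
  have e : (fun x ↦ (u + c • v) x * cexp (-(π * I * n * x / a)))
      = fun x ↦ u x * cexp (-(π * I * n * x / a)) + c * (v x * cexp (-(π * I * n * x / a))) := by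
    funext x
    simp only [Pi.add_apply, Pi.smul_apply, smul_eq_mul]
    ring
  rw [e, intervalIntegral.integral_add hIu (hIv.const_mul c), intervalIntegral.integral_const_mul]

/-- `proj a N (u + c•v) = proj a N u + c • proj a N v` for `u, v` continuous on the closed window. -/
theorem proj_add_smul_of_continuousOn (ha : 0 ≤ a) (hu : ContinuousOn u (Icc (-a) a))
    (hv : ContinuousOn v (Icc (-a) a)) (c : ℂ) (N : ℕ) :
    proj a N (u + c • v) = proj a N u + c • proj a N v := by
  unfold proj
  rw [Finset.smul_sum, ← Finset.sum_add_distrib]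
  refine Finset.sum_congr rfl fun n _ ↦ ?_
  rw [fourierCoeff_add_smul_of_continuousOn ha hu hv c n, mul_add, add_smul, smul_smul]
  congr 2
  ring

/-- The Fourier truncation of any function is a window function (`a > 0`). -/
theorem isWindowFunction_proj (ha : 0 < a) (N : ℕ) (φ : ℝ → ℂ) : IsWindowFunction a (proj a N φ) :=
  IsWindowFunction.sum (modes N) _ fun n _ ↦ isWindowFunction_chi ha n

/-! ## The sesquilinear dictionary for the summable class -/

/-- Summability of the coefficients of `u + c•v` from those of `u` and `v` (with a weight `w ≥ 0`). -/
theorem summable_weight_mul_norm_fourierCoeff_add_smul (ha : 0 ≤ a) (hu : ContinuousOn u (Icc (-a) a))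
    (hv : ContinuousOn v (Icc (-a) a)) (c : ℂ) {w : ℤ → ℝ} (hw : ∀ n, 0 ≤ w n)
    (hsu : Summable fun n : ℤ ↦ w n * ‖Yoshida1992.fourierCoeff a n u‖)
    (hsv : Summable fun n : ℤ ↦ w n * ‖Yoshida1992.fourierCoeff a n v‖) :
    Summable fun n : ℤ ↦ w n * ‖Yoshida1992.fourierCoeff a n (u + c • v)‖ := by
  refine Summable.of_nonneg_of_le (fun n ↦ mul_nonneg (hw n) (norm_nonneg _)) (fun n ↦ ?_)
    (hsu.add (hsv.mul_left ‖c‖))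
  rw [fourierCoeff_add_smul_of_continuousOn ha hu hv c n]
  calc w n * ‖Yoshida1992.fourierCoeff a n u + c * Yoshida1992.fourierCoeff a n v‖
      ≤ w n * (‖Yoshida1992.fourierCoeff a n u‖ + ‖c‖ * ‖Yoshida1992.fourierCoeff a n v‖) := by
        refine mul_le_mul_of_nonneg_left ((norm_add_le _ _).trans ?_) (hw n)
        rw [norm_mul]
    _ = w n * ‖Yoshida1992.fourierCoeff a n u‖ + ‖c‖ * (w n * ‖Yoshida1992.fourierCoeff a n v‖) := by ring

/-- **The sesquilinear window dictionary, summable class.**  For `u, v` window functions (`a > 0`) that are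
continuous on the closed window with `u(−a) = u(a)`, `v(−a) = v(a)` and have coefficients with `Σ|c_n| < ∞`,
`Σ|n||c_n| < ∞`: `weilWindowSesq a (proj a N u) (proj a N v) → weilWindowSesq a u v`. -/
theorem tendsto_weilWindowSesq_proj_of_summable (ha : 0 < a)
    (hu : IsWindowFunction a u) (hv : IsWindowFunction a v)
    (hcu : ContinuousOn u (Icc (-a) a)) (hcv : ContinuousOn v (Icc (-a) a))
    (heu : u (-a) = u a) (hev : v (-a) = v a)
    (hsu0 : Summable fun n : ℤ ↦ ‖Yoshida1992.fourierCoeff a n u‖)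
    (hsu1 : Summable fun n : ℤ ↦ |(n : ℝ)| ^ 1 * ‖Yoshida1992.fourierCoeff a n u‖)
    (hsv0 : Summable fun n : ℤ ↦ ‖Yoshida1992.fourierCoeff a n v‖)
    (hsv1 : Summable fun n : ℤ ↦ |(n : ℝ)| ^ 1 * ‖Yoshida1992.fourierCoeff a n v‖) :
    Tendsto (fun N ↦ weilWindowSesq a (proj a N u) (proj a N v)) atTop (𝓝 (weilWindowSesq a u v)) := by
  refine tendsto_weilWindowSesq_of_forms ha.le (fun N ↦ isWindowFunction_proj ha N u)
    (fun N ↦ isWindowFunction_proj ha N v) hu hv fun c _ ↦ ?_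
  have e : (fun N ↦ weilWindowForm a (proj a N u + c • proj a N v)) = fun N ↦ weilWindowForm a (proj a N (u + c • v)) :=
    funext fun N ↦ by rw [proj_add_smul_of_continuousOn ha.le hcu hcv c N]
  rw [e]
  refine tendsto_weilWindowForm_proj_of_summable ha (fun x hx ↦ ?_) ?_ ?_ ?_ ?_
  · simp only [Pi.add_apply, Pi.smul_apply, smul_eq_mul, hu.eq_zero x hx, hv.eq_zero x hx, mul_zero, add_zero]
  · have : (u + c • v) = fun x ↦ u x + c * v x := by
      funext x
      simp only [Pi.add_apply, Pi.smul_apply, smul_eq_mul]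
    rw [this]
    exact hcu.add (continuousOn_const.mul hcv)
  · simp only [Pi.add_apply, Pi.smul_apply, smul_eq_mul, heu, hev]
  · have h := summable_weight_mul_norm_fourierCoeff_add_smul ha.le hcu hcv c (w := fun _ ↦ (1 : ℝ))
      (fun _ ↦ zero_le_one) (by simpa using hsu0) (by simpa using hsv0)
    simpa using h
  · exact summable_weight_mul_norm_fourierCoeff_add_smul ha.le hcu hcv c (fun n ↦ by positivity) hsu1 hsv1

end Summit.RiemannHypothesis.RiemannHypothesis.Theorems.WeilFormatC

end
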